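import Mathlib.Tactic.Group
import Literature.AnabelianGeometry.SemiGraphs.ArithTemperedGroupOfOuterAction
import HarnessLib

/-!
# [SemiAnbd] §0 p. 5 / Thm 5.4 (iii) p. 66: FUNCTORIALITY of the outer semi-direct product —
# the arithmetic `B^temp(φ) : Π^temp_𝔊 → Π^temp_ℍ` AT THE OUTER MODELS `π₁^temp(𝒢) ⋊^out Π_A`

Mochizuki, *Semi-graphs of anabelioids*, Publ. RIMS **42** (2006), §0 p. 5 (the outer semi-direct
product `G ⋊^out J := Aut(G) ×_{Out(G)} J`, "we have a natural exact sequence `1 → G → G ⋊^out J → J → 1`"),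
§5 Def 5.1 (iv) p. 63, Prop 5.2 (iv) p. 64 and Thm 5.4 (iii) p. 66 ("the functor `B^temp(−)`", "the
homomorphism `Π^temp_𝔊 → Π^temp_ℍ` induced by `φ`") [cite: MochizukiSemiAnbd2006, Thm 5.4 (iii) p.66].

Cell abc-iut, layer L3, sub-DAG [SemiAnbd] Thm 5.4, row «T54iii·btemp-outerModel» (seat abc-iut-w4-d053
gen 4; the T54 junction umbrella of abc-iut-w5-d141, `ArithThm54iiiUmbrellaOfChartDict.lean`, binds the
datum `btemp` — "apply `B^temp(−)`" — together with its laws `hover` / `hbtempφ`; abc-iut-w4-d089's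
corollary (iii) instantiates the umbrella at the OUTER MODELS `Gtp := π₁^temp(𝒢) ⋊^out_{ρ_𝒢} Π_A`,
`Htp := π₁^temp(ℋ) ⋊^out_{ρ_ℋ} Π_{A′}` of abc-iut-L3-d2 / this seat's lineage
(`ArithTemperedGroupOfOuterAction.lean`).  This file supplies the CANONICAL such datum there.)

PURE GROUP THEORY.  For topological groups `G`, `H`, outer actions `ρG : J → Out(G)`, `ρH : J′ → Out(H)`,
a homomorphism `e : J → J′` and a homomorphism `f : G → H` whose image has TRIVIAL CENTRALISER in `H`
(`hZ`; automatic for an open image in a slim group, `centraliserFree_of_isSlimGroup`), suppose every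
element `p = (β, a)` of `G ⋊^out J` admits a bi-continuous automorphism `β′` of `H` in the outer class
`ρH (e a)` TRANSPORTING `β` ALONG `f` (`β′ ∘ f = f ∘ β`) — the compatibility of `f` with the two outer
actions (`hcompat`; it suffices to have it for ONE representative of each `ρG a`,
`compat_of_representatives`).  Then:

* `transportAut_unique` — such a `β′` is UNIQUE (two of them differ by an inner automorphism centralising
  `f(G)`);
* **`outerSemidirectProductMap`** — `(β, a) ↦ (β′, e a)` is a group homomorphism
  `G ⋊^out_{ρG} J → H ⋊^out_{ρH} J′` (the DEFINITION of this file);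
* `outerSemidirectProductMap_toOuterSemidirectProduct` — it restricts to `f` on `G`:
  `map (ι_G x) = ι_H (f x)` (the law `hbtempφ` of the umbrella, with `δ = 1`);
* `outerSemidirectProductSnd_comp_outerSemidirectProductMap` — it covers `e`: `aug_H ∘ map = e ∘ aug_G`
  (the law `hover`);
* `eq_outerSemidirectProductMap` — it is the ONLY homomorphism with these two properties;
* `outerSemidirectProductMap_injective` — it is injective when `f` and `e` are.

No new named fact, no instance, nothing asserted about the paper beyond what is proved; the continuity
of the map for the tempered LEVEL topologies (abc-iut-w6-d070's `arithLevelTopology`) is NOT treated here.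
Nothing here bears on [IUTchIII] Cor. 3.12; typed ≠ proved elsewhere.
-/

namespace Literature.AnabelianGeometry.SemiGraphs

open Literature.AnabelianGeometry.EtaleTheta

section Functoriality

variable {G : Type*} [Group G] [TopologicalSpace G]
  {H : Type*} [Group H] [TopologicalSpace H]
  {J : Type*} [Group J] {J' : Type*} [Group J']
  (ρG : J →* TopOut G) (ρH : J' →* TopOut H) (e : J →* J') (f : G →* H)

omit [TopologicalSpace G] in
/-- "Centraliser-free image": no non-trivial element of `H` centralises `f(G)` (for `f` the inclusion of
an open subgroup of a slim group this is slimness, [SemiAnbd] §0 "Topological Groups").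
[cite: MochizukiSemiAnbd2006, §0 p.5] -/
theorem centraliserFree_of_isSlimGroup
    (hS : Literature.AlgebraicGeometry.Frobenioids.IsSlimGroup H) (hf : IsOpen (f.range : Set H)) :
    ∀ h : H, (∀ y : G, h * f y * h⁻¹ = f y) → h = 1 := by
  intro h hh
  have hmem : h ∈ Subgroup.centralizer (f.range : Set H) := by
    rw [Subgroup.mem_centralizer_iff]
    rintro _ ⟨y, rfl⟩
    have := hh y
    calc f y * h = h * f y * h⁻¹ * h := by rw [this]
      _ = h * f y := by group
  rw [hS.centralizer_eq_bot f.range hf] at hmem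
  exact (Subgroup.mem_bot).mp hmem

omit [TopologicalSpace G] [TopologicalSpace H] in
/-- A centraliser-free image forces `H` to be centre-free. [cite: MochizukiSemiAnbd2006, §0 p.5] -/
theorem center_eq_bot_of_centraliserFree (hZ : ∀ h : H, (∀ y : G, h * f y * h⁻¹ = f y) → h = 1) :
    Subgroup.center H = ⊥ := by
  rw [eq_bot_iff]
  intro z hz
  rw [Subgroup.mem_bot]
  refine hZ z fun y => ?_
  have := (Subgroup.mem_center_iff.mp hz) (f y)
  rw [← this]; group

omit [TopologicalSpace G] in
/-- **Uniqueness of the transported automorphism**: two bi-continuous automorphisms of `H` in the SAME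
outer class which both transport an automorphism `β` of `G` along `f` (`βᵢ′ ∘ f = f ∘ β`) coincide — they
differ by an inner automorphism `conj h` with `h` centralising `f(β(G)) = f(G)`.
[cite: MochizukiSemiAnbd2006, §0 p.5] -/
theorem transportAut_unique (hZ : ∀ h : H, (∀ y : G, h * f y * h⁻¹ = f y) → h = 1) (β : MulAut G)
    {β₁ β₂ : contMulAut H} (hmk : TopOut.mk H β₁ = TopOut.mk H β₂)
    (h₁ : ∀ y, (β₁ : MulAut H) (f y) = f (β y)) (h₂ : ∀ y, (β₂ : MulAut H) (f y) = f (β y)) :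
    β₁ = β₂ := by
  obtain ⟨h, hh⟩ := exists_conj_of_mk_eq β₁ β₂ hmk
  -- `hh : ∀ x, β₂ x = h * β₁ x * h⁻¹`; `h` centralises `f(G)`:
  have hc : ∀ y : G, h * f y * h⁻¹ = f y := by
    intro y
    obtain ⟨y', rfl⟩ := β.surjective y
    rw [← h₁, ← hh, h₂, h₁]
  have h1 : h = 1 := hZ h hc
  apply Subtype.ext
  ext x
  rw [hh x, h1, one_mul, inv_one, mul_one]

/-- The compatibility datum for ALL of `G ⋊^out J` from compatible REPRESENTATIVES: if every `a ∈ J`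
has some representative `β` of `ρG a` transported along `f` by some representative `β′` of `ρH (e a)`,
then every `(β, a) ∈ G ⋊^out J` is so transported (the other representatives of `ρG a` are `conj g ∘ β`,
transported by `conj (f g) ∘ β′`). [cite: MochizukiSemiAnbd2006, §0 p.5] -/
theorem compat_of_representatives [IsTopologicalGroup H]
    (hrep : ∀ a : J, ∃ β : contMulAut G, TopOut.mk G β = ρG a ∧
      ∃ β' : contMulAut H, TopOut.mk H β' = ρH (e a) ∧ ∀ y, (β' : MulAut H) (f y) = f ((β : MulAut G) y)) :
    ∀ p : outerSemidirectProduct ρG, ∃ β' : contMulAut H,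
      TopOut.mk H β' = ρH (e (outerSemidirectProductSnd ρG p)) ∧
        ∀ y, (β' : MulAut H) (f y) = f ((p.1.1 : MulAut G) y) := by
  intro p
  obtain ⟨β, hβ, β', hβ', hf⟩ := hrep (outerSemidirectProductSnd ρG p)
  obtain ⟨g, hg⟩ := exists_conj_of_mk_eq β p.1.1 (by rw [hβ, mk_fst_eq_rho_snd])
  -- `hg : ∀ x, p.1.1 x = g * β x * g⁻¹`
  refine ⟨⟨MulAut.conj (f g), innerAut_le_contMulAut H ⟨f g, rfl⟩⟩ * β', ?_, fun y => ?_⟩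
  · rw [map_mul, ← hβ', mul_eq_right, QuotientGroup.mk'_apply, QuotientGroup.eq_one_iff]
    exact ⟨f g, rfl⟩
  · rw [hg, map_mul, map_mul, map_inv, ← hf]
    rfl

variable (hcompat : ∀ p : outerSemidirectProduct ρG, ∃ β' : contMulAut H,
    TopOut.mk H β' = ρH (e (outerSemidirectProductSnd ρG p)) ∧
      ∀ y, (β' : MulAut H) (f y) = f ((p.1.1 : MulAut G) y))
  (hZ : ∀ h : H, (∀ y : G, h * f y * h⁻¹ = f y) → h = 1)

/-- **`B^temp(φ)` at the outer models (§0 p. 5 functoriality of `⋊^out`)**: the homomorphism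
`G ⋊^out_{ρG} J → H ⋊^out_{ρH} J′`, `(β, a) ↦ (β′, e a)` with `β′` THE bi-continuous automorphism of `H` in
the class `ρH (e a)` transporting `β` along `f` (exists by `hcompat`, unique by `transportAut_unique`).
[cite: MochizukiSemiAnbd2006, Thm 5.4 (iii) p.66] -/
noncomputable def outerSemidirectProductMap :
    outerSemidirectProduct ρG →* outerSemidirectProduct ρH where
  toFun p := ⟨((hcompat p).choose, e (outerSemidirectProductSnd ρG p)), (hcompat p).choose_spec.1⟩
  map_one' := by
    apply Subtype.ext
    refine Prod.ext ?_ (by simp)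
    change (hcompat 1).choose = 1
    refine transportAut_unique f hZ 1 ?_ (hcompat 1).choose_spec.2 (fun y => rfl)
    rw [(hcompat 1).choose_spec.1, map_one, map_one, map_one, map_one]
  map_mul' p q := by
    apply Subtype.ext
    refine Prod.ext ?_ ?_
    · change (hcompat (p * q)).choose = (hcompat p).choose * (hcompat q).choose
      refine transportAut_unique f hZ ((p * q).1.1 : MulAut G) ?_ (hcompat (p * q)).choose_spec.2 ?_
      · rw [(hcompat (p * q)).choose_spec.1, map_mul (TopOut.mk H), (hcompat p).choose_spec.1,
          (hcompat q).choose_spec.1, ← map_mul, ← map_mul, ← map_mul]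
      · intro y
        change ((hcompat p).choose : MulAut H) (((hcompat q).choose : MulAut H) (f y)) =
          f ((p.1.1 : MulAut G) ((q.1.1 : MulAut G) y))
        rw [(hcompat q).choose_spec.2, (hcompat p).choose_spec.2]
    · change e (outerSemidirectProductSnd ρG (p * q)) =
        e (outerSemidirectProductSnd ρG p) * e (outerSemidirectProductSnd ρG q)
      rw [map_mul, map_mul]

/-- The `J′`-component of `map p` is `e (aug p)`. [cite: MochizukiSemiAnbd2006, §0 p.5] -/
@[simp] theorem outerSemidirectProductSnd_outerSemidirectProductMap (p : outerSemidirectProduct ρG) :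
    outerSemidirectProductSnd ρH (outerSemidirectProductMap ρG ρH e f hcompat hZ p) =
      e (outerSemidirectProductSnd ρG p) := rfl

/-- **`hover`**: the map covers `e` — `aug_H ∘ map = e ∘ aug_G`. [cite: MochizukiSemiAnbd2006, Thm 5.4 (iii) p.66] -/
theorem outerSemidirectProductSnd_comp_outerSemidirectProductMap :
    (outerSemidirectProductSnd ρH).comp (outerSemidirectProductMap ρG ρH e f hcompat hZ) =
      e.comp (outerSemidirectProductSnd ρG) := by
  ext p; rfl

/-- The `Aut`-component of `map p` TRANSPORTS the `Aut`-component of `p` along `f`.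
[cite: MochizukiSemiAnbd2006, §0 p.5] -/
theorem outerSemidirectProductMap_fst_apply (p : outerSemidirectProduct ρG) (y : G) :
    ((outerSemidirectProductMap ρG ρH e f hcompat hZ p).1.1 : MulAut H) (f y) = f ((p.1.1 : MulAut G) y) :=
  (hcompat p).choose_spec.2 y

/-- The `Aut`-component of `map p` is characterised by its outer class and the transport property.
[cite: MochizukiSemiAnbd2006, §0 p.5] -/
theorem outerSemidirectProductMap_fst_eq (p : outerSemidirectProduct ρG) (β' : contMulAut H)
    (hmk : TopOut.mk H β' = ρH (e (outerSemidirectProductSnd ρG p)))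
    (hβ' : ∀ y, (β' : MulAut H) (f y) = f ((p.1.1 : MulAut G) y)) :
    (outerSemidirectProductMap ρG ρH e f hcompat hZ p).1.1 = β' :=
  transportAut_unique f hZ (p.1.1 : MulAut G) (((hcompat p).choose_spec.1).trans hmk.symm)
    (hcompat p).choose_spec.2 hβ'

variable [IsTopologicalGroup G] [IsTopologicalGroup H]

/-- **`hbtempφ` (with `δ = 1`)**: the map restricts to `f` on `G` — `map (ι_G x) = ι_H (f x)`.
[cite: MochizukiSemiAnbd2006, Thm 5.4 (iii) p.66] -/
theorem outerSemidirectProductMap_toOuterSemidirectProduct (x : G) :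
    outerSemidirectProductMap ρG ρH e f hcompat hZ (toOuterSemidirectProduct ρG x) =
      toOuterSemidirectProduct ρH (f x) := by
  apply Subtype.ext
  refine Prod.ext ?_ ?_
  · change (outerSemidirectProductMap ρG ρH e f hcompat hZ (toOuterSemidirectProduct ρG x)).1.1 =
      ⟨MulAut.conj (f x), innerAut_le_contMulAut H ⟨f x, rfl⟩⟩
    refine outerSemidirectProductMap_fst_eq ρG ρH e f hcompat hZ _ _ ?_ fun y => ?_
    · rw [outerSemidirectProductSnd_toOuterSemidirectProduct, map_one, map_one, QuotientGroup.mk'_apply,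
        QuotientGroup.eq_one_iff]
      exact ⟨f x, rfl⟩
    · change f x * f y * (f x)⁻¹ = f (x * y * x⁻¹)
      rw [map_mul, map_mul, map_inv]
  · change e (outerSemidirectProductSnd ρG (toOuterSemidirectProduct ρG x)) = 1
    rw [outerSemidirectProductSnd_toOuterSemidirectProduct, map_one]

/-- The same as an identity of homomorphisms: `map ∘ ι_G = ι_H ∘ f`. [cite: MochizukiSemiAnbd2006, Thm 5.4 (iii) p.66] -/
theorem outerSemidirectProductMap_comp_toOuterSemidirectProduct :
    (outerSemidirectProductMap ρG ρH e f hcompat hZ).comp (toOuterSemidirectProduct ρG) =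
      (toOuterSemidirectProduct ρH).comp f := by
  ext x : 1
  exact outerSemidirectProductMap_toOuterSemidirectProduct ρG ρH e f hcompat hZ x

/-- **Uniqueness of `B^temp(φ)` at the outer models**: a homomorphism `G ⋊^out J → H ⋊^out J′` restricting
to `f` on `G` and covering `e` IS `outerSemidirectProductMap` (conjugation formula in `H ⋊^out J′` +
injectivity of `ι_H`, `H` being centre-free). [cite: MochizukiSemiAnbd2006, Thm 5.4 (iii) p.66] -/
theorem eq_outerSemidirectProductMap (B : outerSemidirectProduct ρG →* outerSemidirectProduct ρH)
    (hι : ∀ x, B (toOuterSemidirectProduct ρG x) = toOuterSemidirectProduct ρH (f x))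
    (haug : ∀ p, outerSemidirectProductSnd ρH (B p) = e (outerSemidirectProductSnd ρG p)) :
    B = outerSemidirectProductMap ρG ρH e f hcompat hZ := by
  have hinj := toOuterSemidirectProduct_injective ρH (center_eq_bot_of_centraliserFree f hZ)
  ext p : 1
  apply Subtype.ext
  refine Prod.ext ?_ (haug p)
  symm
  refine outerSemidirectProductMap_fst_eq ρG ρH e f hcompat hZ p (B p).1.1 ?_ fun y => hinj ?_
  · rw [mk_fst_eq_rho_snd, haug]
  · rw [← conj_toOuterSemidirectProduct, ← hι, ← hι, ← map_mul, ← map_inv, ← map_mul,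
      conj_toOuterSemidirectProduct]

/-- `map` is injective when `f` and `e` are (exactness of `1 → G → G ⋊^out J → J → 1` and injectivity of
`ι_H`). [cite: MochizukiSemiAnbd2006, §0 p.5] -/
theorem outerSemidirectProductMap_injective (hf : Function.Injective f) (he : Function.Injective e) :
    Function.Injective (outerSemidirectProductMap ρG ρH e f hcompat hZ) := by
  rw [injective_iff_map_eq_one]
  intro p hp
  have haug : outerSemidirectProductSnd ρG p = 1 := by
    apply he
    rw [map_one, ← outerSemidirectProductSnd_outerSemidirectProductMap ρG ρH e f hcompat hZ p, hp, map_one]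
  have hmem : p ∈ (toOuterSemidirectProduct ρG).range := by
    rw [range_toOuterSemidirectProduct_eq_ker]
    exact haug
  obtain ⟨x, rfl⟩ := hmem
  rw [outerSemidirectProductMap_toOuterSemidirectProduct] at hp
  have hx : f x = 1 :=
    toOuterSemidirectProduct_injective ρH (center_eq_bot_of_centraliserFree f hZ) (by rw [hp, map_one])
  rw [hf (hx.trans (map_one f).symm), map_one]

omit [IsTopologicalGroup G] in
/-- Conjugation by `map p` on `ι_H(f(G))` is `f`-transport of conjugation by `p`:
`map p · ι_H (f y) · (map p)⁻¹ = ι_H (f (φ_p y))`. [cite: MochizukiSemiAnbd2006, §0 p.5] -/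
theorem conj_outerSemidirectProductMap_toOuterSemidirectProduct (p : outerSemidirectProduct ρG) (y : G) :
    outerSemidirectProductMap ρG ρH e f hcompat hZ p * toOuterSemidirectProduct ρH (f y) *
        (outerSemidirectProductMap ρG ρH e f hcompat hZ p)⁻¹ =
      toOuterSemidirectProduct ρH (f ((p.1.1 : MulAut G) y)) := by
  rw [conj_toOuterSemidirectProduct, outerSemidirectProductMap_fst_apply]

/-- Image of `ι_G(K)` for a subgroup `K ≤ G`: `map (ι_G K) = ι_H (f K)`. [cite: MochizukiSemiAnbd2006, §0 p.5] -/
theorem map_outerSemidirectProductMap_map_toOuterSemidirectProduct (K : Subgroup G) :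
    (K.map (toOuterSemidirectProduct ρG)).map (outerSemidirectProductMap ρG ρH e f hcompat hZ) =
      (K.map f).map (toOuterSemidirectProduct ρH) := by
  rw [Subgroup.map_map, Subgroup.map_map, outerSemidirectProductMap_comp_toOuterSemidirectProduct]

end Functoriality

/-! ### At the tempered charts: `B^temp(φ)` for `Π^temp_𝔊 := π₁^temp(𝒢) ⋊^out Π_A`, `Π^temp_ℍ := π₁^temp(ℋ) ⋊^out Π_{A′}` -/

namespace ProfiniteSemiGraph

universe u w w'

variable {𝒢 ℋ : ProfiniteSemiGraph.{u}} (c𝒢 : TemperedPiChart 𝒢) (cℋ : TemperedPiChart ℋ)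
  {PA : Type w} [Group PA] {PA' : Type w'} [Group PA']
  (ρ𝒢 : PA →* TopOut c𝒢.G) (ρℋ : PA' →* TopOut cℋ.G) (e : PA →* PA') (φ : c𝒢.G →* cℋ.G)

/-- **`hZ` at the charts**: a homomorphism `φ̂ : π₁^temp(𝒢) → π₁^temp(ℋ)` with OPEN image has
centraliser-free image, `π₁^temp(ℋ)` being temp-slim (abc-iut-L3-t2's `temperedPiSlim_holds`, Prop 3.6 /
Ex 3.10). [cite: MochizukiSemiAnbd2006, Prop 3.6 p.38] -/
theorem centraliserFree_of_isOpen_range (h36 : ℋ.Prop36Hypotheses) (hφ : IsOpen (φ.range : Set cℋ.G)) :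
    ∀ h : cℋ.G, (∀ y : c𝒢.G, h * φ y * h⁻¹ = φ y) → h = 1 :=
  centraliserFree_of_isSlimGroup φ (temperedPiSlim_holds ℋ h36 cℋ) hφ

/-- **`B^temp(φ)` at the outer models of two tempered charts** (the datum `btemp φ` of the T54 junction
umbrella at abc-iut-w4-d089's design (D)): for `φ̂ : π₁^temp(𝒢) → π₁^temp(ℋ)` with centraliser-free image,
compatible with the outer actions `ρ_𝒢`, `ρ_ℋ ∘ e` (compatibility for ONE representative per `a ∈ Π_A`
suffices), the homomorphism `Π^temp_𝔊 → Π^temp_ℍ` restricting to `φ̂` on `π₁^temp(𝒢)` (law `hbtempφ`,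
`δ = 1`) and covering `e` (law `hover`) EXISTS and is UNIQUE. [cite: MochizukiSemiAnbd2006, Thm 5.4 (iii) p.66] -/
theorem existsUnique_btemp_outerAction (hZ : ∀ h : cℋ.G, (∀ y : c𝒢.G, h * φ y * h⁻¹ = φ y) → h = 1)
    (hrep : ∀ a : PA, ∃ β : contMulAut c𝒢.G, TopOut.mk c𝒢.G β = ρ𝒢 a ∧
      ∃ β' : contMulAut cℋ.G, TopOut.mk cℋ.G β' = ρℋ (e a) ∧
        ∀ y, (β' : MulAut cℋ.G) (φ y) = φ ((β : MulAut c𝒢.G) y)) :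
    ∃! B : outerSemidirectProduct ρ𝒢 →* outerSemidirectProduct ρℋ,
      (∀ x, B (toOuterSemidirectProduct ρ𝒢 x) = toOuterSemidirectProduct ρℋ (φ x)) ∧
        ∀ p, outerSemidirectProductSnd ρℋ (B p) = e (outerSemidirectProductSnd ρ𝒢 p) := by
  have hcompat := compat_of_representatives ρ𝒢 ρℋ e φ hrep
  exact ⟨outerSemidirectProductMap ρ𝒢 ρℋ e φ hcompat hZ,
    ⟨outerSemidirectProductMap_toOuterSemidirectProduct ρ𝒢 ρℋ e φ hcompat hZ,
      outerSemidirectProductSnd_outerSemidirectProductMap ρ𝒢 ρℋ e φ hcompat hZ⟩,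
    fun B hB => eq_outerSemidirectProductMap ρ𝒢 ρℋ e φ hcompat hZ B hB.1 hB.2⟩

end ProfiniteSemiGraph

/-! ### Appendix (v2): compatibility from chart-level conjugators; inner twists of `f` (clause (2) of Thm 5.4 (iii)) -/

section FunctorialityTwists

variable {G : Type*} [Group G] [TopologicalSpace G]
  {H : Type*} [Group H] [TopologicalSpace H] [IsTopologicalGroup H]
  {J : Type*} [Group J] {J' : Type*} [Group J']
  (ρG : J →* TopOut G) (ρH : J' →* TopOut H) (e : J →* J') (f : G →* H)

/-- **The representative-currency compatibility from chart-level data UP TO CONJUGATION**: if for every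
`a ∈ J` chosen representatives `cγ a` of `ρG a` and `cη a` of `ρH (e a)` satisfy
`cη a ∘ f = conj (k a) ∘ f ∘ cγ a` for some `k a ∈ H` (the shape in which Prop 3.2 / the 2-cells of a
dictionary of arrows deliver the compatibility of `φ` with the `Π_A`-actions), then the hypothesis `hrep` of
`compat_of_representatives` holds (replace `cη a` by `conj (k a)⁻¹ ∘ cη a`).
[cite: MochizukiSemiAnbd2006, Thm 5.4 (iii) p.66] -/
theorem representatives_of_conj (cγ : J → contMulAut G) (hcγ : ∀ a, TopOut.mk G (cγ a) = ρG a)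
    (cη : J → contMulAut H) (hcη : ∀ a, TopOut.mk H (cη a) = ρH (e a)) (k : J → H)
    (hk : ∀ a y, (cη a : MulAut H) (f y) = k a * f ((cγ a : MulAut G) y) * (k a)⁻¹) :
    ∀ a : J, ∃ β : contMulAut G, TopOut.mk G β = ρG a ∧
      ∃ β' : contMulAut H, TopOut.mk H β' = ρH (e a) ∧ ∀ y, (β' : MulAut H) (f y) = f ((β : MulAut G) y) := by
  intro a
  refine ⟨cγ a, hcγ a, ⟨MulAut.conj (k a)⁻¹, innerAut_le_contMulAut H ⟨(k a)⁻¹, rfl⟩⟩ * cη a, ?_, fun y => ?_⟩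
  · rw [map_mul, hcη, mul_eq_right, QuotientGroup.mk'_apply, QuotientGroup.eq_one_iff]
    exact ⟨(k a)⁻¹, rfl⟩
  · change (k a)⁻¹ * (cη a : MulAut H) (f y) * (k a)⁻¹⁻¹ = f ((cγ a : MulAut G) y)
    rw [hk, inv_inv]
    group

variable (hcompat : ∀ p : outerSemidirectProduct ρG, ∃ β' : contMulAut H,
    TopOut.mk H β' = ρH (e (outerSemidirectProductSnd ρG p)) ∧
      ∀ y, (β' : MulAut H) (f y) = f ((p.1.1 : MulAut G) y))
  (hZ : ∀ h : H, (∀ y : G, h * f y * h⁻¹ = f y) → h = 1)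

omit [TopologicalSpace G] [TopologicalSpace H] [IsTopologicalGroup H] in
include hZ in
/-- An inner twist `conj k ∘ f` of `f` again has centraliser-free image. [cite: MochizukiSemiAnbd2006, §0 p.5] -/
theorem centraliserFree_conj (k : H) :
    ∀ h : H, (∀ y : G, h * ((MulAut.conj k).toMonoidHom.comp f) y * h⁻¹ =
      ((MulAut.conj k).toMonoidHom.comp f) y) → h = 1 := by
  intro h hh
  have hk : k⁻¹ * h * k = 1 := by
    refine hZ (k⁻¹ * h * k) fun y => ?_
    have := hh y
    simp only [MonoidHom.coe_comp, MulEquiv.coe_toMonoidHom, Function.comp_apply, MulAut.conj_apply] at this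
    calc k⁻¹ * h * k * f y * (k⁻¹ * h * k)⁻¹ = k⁻¹ * (h * (k * f y * k⁻¹) * h⁻¹) * k := by group
      _ = k⁻¹ * (k * f y * k⁻¹) * k := by rw [this]
      _ = f y := by group
  calc h = k * (k⁻¹ * h * k) * k⁻¹ := by group
    _ = 1 := by rw [hk]; group

include hcompat in
/-- An inner twist `conj k ∘ f` of `f` is again compatible with the outer actions (twist the transporting
automorphisms by `conj k`). [cite: MochizukiSemiAnbd2006, §0 p.5] -/
theorem compat_conj (k : H) :
    ∀ p : outerSemidirectProduct ρG, ∃ β' : contMulAut H,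
      TopOut.mk H β' = ρH (e (outerSemidirectProductSnd ρG p)) ∧
        ∀ y, (β' : MulAut H) (((MulAut.conj k).toMonoidHom.comp f) y) =
          ((MulAut.conj k).toMonoidHom.comp f) ((p.1.1 : MulAut G) y) := by
  intro p
  obtain ⟨β', hβ', hf⟩ := hcompat p
  let κ : contMulAut H := ⟨MulAut.conj k, innerAut_le_contMulAut H ⟨k, rfl⟩⟩
  refine ⟨κ * β' * κ⁻¹, ?_, fun y => ?_⟩
  · have hκ : TopOut.mk H κ = 1 := by
      rw [QuotientGroup.mk'_apply, QuotientGroup.eq_one_iff]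
      exact ⟨k, rfl⟩
    rw [map_mul, map_mul, map_inv, hκ, hβ', one_mul, inv_one, mul_one]
  · change k * (β' : MulAut H) ((MulAut.conj k)⁻¹ (k * f y * k⁻¹)) * k⁻¹ =
      k * f ((p.1.1 : MulAut G) y) * k⁻¹
    rw [MulAut.conj_inv_apply, ← hf]
    congr 2
    group

/-- **Inner twists (clause (2) of Thm 5.4 (iii) at the outer models, direction ⇒)**: the homomorphism of
outer semi-direct products induced by the inner twist `conj k ∘ f` (`k ∈ H`) is the `ι_H(k)`-conjugate of
the one induced by `f` — "`B^temp(ψ)` is an inner conjugate of `B^temp(φ)`" when `ψ̂ = conj k ∘ φ̂`.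
[cite: MochizukiSemiAnbd2006, Thm 5.4 (iii) p.66] -/
theorem outerSemidirectProductMap_conj [IsTopologicalGroup G] (k : H)
    (hcompat' : ∀ p : outerSemidirectProduct ρG, ∃ β' : contMulAut H,
      TopOut.mk H β' = ρH (e (outerSemidirectProductSnd ρG p)) ∧
        ∀ y, (β' : MulAut H) (((MulAut.conj k).toMonoidHom.comp f) y) =
          ((MulAut.conj k).toMonoidHom.comp f) ((p.1.1 : MulAut G) y))
    (hZ' : ∀ h : H, (∀ y : G, h * ((MulAut.conj k).toMonoidHom.comp f) y * h⁻¹ =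
      ((MulAut.conj k).toMonoidHom.comp f) y) → h = 1) :
    outerSemidirectProductMap ρG ρH e ((MulAut.conj k).toMonoidHom.comp f) hcompat' hZ' =
      (MulAut.conj (toOuterSemidirectProduct ρH k)).toMonoidHom.comp
        (outerSemidirectProductMap ρG ρH e f hcompat hZ) := by
  symm
  refine eq_outerSemidirectProductMap ρG ρH e _ hcompat' hZ' _ (fun x => ?_) (fun p => ?_)
  · change toOuterSemidirectProduct ρH k * outerSemidirectProductMap ρG ρH e f hcompat hZ
        (toOuterSemidirectProduct ρG x) * (toOuterSemidirectProduct ρH k)⁻¹ =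
      toOuterSemidirectProduct ρH (k * f x * k⁻¹)
    rw [outerSemidirectProductMap_toOuterSemidirectProduct, map_mul, map_mul, map_inv]
  · change outerSemidirectProductSnd ρH (toOuterSemidirectProduct ρH k *
        outerSemidirectProductMap ρG ρH e f hcompat hZ p * (toOuterSemidirectProduct ρH k)⁻¹) =
      e (outerSemidirectProductSnd ρG p)
    rw [map_mul, map_mul, map_inv, outerSemidirectProductSnd_toOuterSemidirectProduct,
      outerSemidirectProductSnd_outerSemidirectProductMap, one_mul, inv_one, mul_one]

end FunctorialityTwists

end Literature.AnabelianGeometry.SemiGraphs
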